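import Mathlib
import Literature.NumberTheory.EllipticCurves.Disegni2017.CyclotomicLineRankinSelberg

/-!
# STUB-IDEAS k2 (gen 21) — typed sketch for `stub_heegnerIndexLowerAtTwo`

Crux item `stmt-BirchSwinnertonDyer-27851` (`PrintCf2.SplitBadTwoLowerHalfOfFacts`, LOWER half
`ord₂ #Ш_an ≤ ord₂ #Ш` for the minimal models of `49a1^{(d)}, 49a2^{(d)}`, `d ≢ 1 (mod 4)`), stub of record
`stub_heegnerIndexLowerAtTwo` (skeleton sha `f2bd84c0…`; conclusion over the Heegner field `K`:
`2·ord₂[W(K):ℤP] − 2·ord₂ c ≤ ord₂ #Ш(W/K)[2^∞] + ord₂ Tam(W/K)`).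

TECHNIQUE (menu family 1, RECOGNISE & IMPORT): literature MATCH (an audit executed on the pages) +
ANALOGY TRANSFER with a typed dictionary (odd additive `p` ↦ `p = 2` of the tree's
`Literature/NumberTheory/EllipticCurves/Disegni2017/*`; LTYZ 2025 odd-bad case ↦ `p = 2`).

## What this file types (Mathlib only; every `sorry` is a DECLARED helper signature, none is asserted)

* §1 the dyadic Disegni data of the twin class `W = cm7^{(m)} ⊗ χ_e`, `e ∈ {−1, 2, −2}`:
  the unit character of the nearly `2`-ordinary `σ_{W,2}` is `α₂ = α₀·χ_{e,2}` (conductor exponent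
  `c(e) = 2, 3, 3`), Disegni's local factor at BOTH `w ∣ 2` (2 splits in `K`) is the dyadic Gauss sum
  `Z_w(𝟙_w) = τ(α₂∘q_w, ψ) = α₀(2)^{-c}·g(χ_e)`, `g(χ_e)² = χ_e(−1)·2^{c}`, so
  `Z°₂(𝟙_K) = u · χ_e(−1) · 2^{c(e)} · α₀^{−2c(e)}`, `u = ζ_{ℚ₂}(2)L(1,η₂)² = 16/3`, `v₂(Z°₂(𝟙_K)) = 4 + c(e)`.
  (The tree's odd-`p` `Disegni2017.zCircOne p α = u·p*·α⁻²` hard-wires `ε = (p*/·)` of conductor `p`;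
  at `p = 2` its `legendreLevel` is `quadraticChar (ZMod 2) = 𝟙`, i.e. it silently describes the GOOD
  ordinary unit character — LTYZ's case, not ours; hence the `…Two` variants below.)
* §2 the MC⁻ valuation step on the cyclotomic line, PROVED: if `G ∣ f` in `ℤ_p⟦T⟧` and both vanish
  to order `≥ n` then `‖[Tⁿ]f‖ ≤ ‖[Tⁿ]G‖` (`coeff_mul_eq_of_coeff_lt_eq_zero`, `norm_coeff_mul_le`).
* §3 the LOWER chain over `K` as an integer-valuation shadow, PROVED (`lower_of_disegni_mc_alg`,
  `lower_index_form`): Disegni Thm B ÷ YZZ (1.1.3) at `𝟙_K` + Gross–Zagier rationality + MC⁻ on the line +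
  the one-sided algebraic leading-term inequality ALG⁻ ⟹ `ord₂ Ш_an + κ ≤ ord₂ Ш` with the DIGIT
  `κ = 1 + v₂(Z°₂) − v₂(log₂ γ) + ν + ρ − v_D − δ = 3 + c(e) + ν + ρ − v_D − δ`; the index `I`, the height
  `h₂(P_K)`, `Tam` and `#tors` CANCEL identically (both sides live over `K`).
* §4 the declared helper signatures (shapes) the stub prover needs: `PAdicRatioClauseAtTwoShape`,
  `controlKernelFiniteOnLine_shape`, `AlgLowerKShape` (the single research helper), `InRangeComparisonShape`.
* §5 (`….Typed`, over the TREE's objects, importing `Disegni2017.CyclotomicLineRankinSelberg`): the `p = 2`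
  twins `CycLineInterpolationTwo` / `zCircTwo` / `PAdicRatioClauseTwo` / `CycLineGrossZagierClausesTwo` of the
  tree's odd-`p` predicates, quantified over `PAdicHeightDataK W 2 K`, `CuspForm (Gamma0 N) 2`,
  `PowerSeries ℂ_[2]`, with the ramified unit character `χ_e` of level `2^c` in place of `legendreLevel p`.

BSD is NOT proved by any of this: the file proves two elementary lemmas and types a dictionary; the
audited theorem (Disegni 2017 Thm B at `p = 2`) enters the harness only as a NAMED FACT used as a
hypothesis, and `AlgLowerK` is open mathematics.
-/

set_option linter.dupNamespace false

namespace Summit.BirchSwinnertonDyer.BirchSwinnertonDyer.Cruxes.SplitBadTwoLowerHalfOfFacts.StubIdeasK2G21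

/-! ## §1 Dyadic Disegni data of the twin class -/

/-- The three dyadic twist classes of `W = cm7^{(m)} ⊗ χ_e` (`m ≡ 1 (mod 4)`):
`e = −1` ↔ keys `(1,3),(1,7)`; `e = 2` ↔ `(0,1),(0,5)`; `e = −2` ↔ `(0,3),(0,7)`. -/
inductive DyadicClass
  | negOne
  | two
  | negTwo
  deriving DecidableEq, Repr

namespace DyadicClass

/-- the twisting discriminant unit `e`. -/
def e : DyadicClass → ℤ
  | negOne => -1
  | two => 2
  | negTwo => -2

/-- conductor exponent `c(e)` of `χ_{e,2}` on `ℤ₂^×`: `χ_{−4}` has conductor `4`, `χ_{±8}` conductor `8`. -/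
def condExp : DyadicClass → ℕ
  | negOne => 2
  | two => 3
  | negTwo => 3

/-- `χ_e(−1)`. -/
def signAtNegOne : DyadicClass → ℤ
  | negOne => -1
  | two => 1
  | negTwo => -1

/-- `g(χ_e)² = χ_e(−1)·2^{c(e)}` — the square of the dyadic Gauss sum (`(2i)² = −4`, `(2√2)² = 8`,
`(2√2·i)² = −8`); recorded as the integer it equals. -/
def gaussSqTwo (κ : DyadicClass) : ℤ := κ.signAtNegOne * 2 ^ κ.condExp

theorem gaussSqTwo_values :
    negOne.gaussSqTwo = -4 ∧ two.gaussSqTwo = 8 ∧ negTwo.gaussSqTwo = -8 := by decide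

/-- the dyadic key `(v₂ d, odd part of d mod 8)` ↦ class. -/
def ofKey : ℕ × ℕ → Option DyadicClass
  | (1, 3) => some negOne
  | (1, 7) => some negOne
  | (0, 1) => some two
  | (0, 5) => some two
  | (0, 3) => some negTwo
  | (0, 7) => some negTwo
  | _ => none

theorem ofKey_total_on_the_six_keys :
    (ofKey (1,3)).isSome ∧ (ofKey (1,7)).isSome ∧ (ofKey (0,1)).isSome ∧ (ofKey (0,5)).isSome ∧
      (ofKey (0,3)).isSome ∧ (ofKey (0,7)).isSome := by decide

/-- `v₂(Z°₂(𝟙_K)) = v₂(16/3) + c(e) = 4 + c(e)`: the `2`-adic valuation of Disegni's interpolation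
factor at the trivial character of `K` for the nearly `2`-ordinary `σ_{W,2}` (both `w ∣ 2`, `2` split in
`K`; `L(1/2, σ_{W,2}) = 1` because `W` is additive at `2`). -/
def zCircTwoVal (κ : DyadicClass) : ℤ := 4 + κ.condExp

theorem zCircTwoVal_values : negOne.zCircTwoVal = 6 ∧ two.zCircTwoVal = 7 ∧ negTwo.zCircTwoVal = 7 := by
  decide

end DyadicClass

/-- Disegni's split local constant `u = ζ_{ℚ_p}(2)·L(1,η_p)² = ((1 − p⁻²)(1 − p⁻¹)²)⁻¹` at `p = 2` is
`16/3` (the tree's `Disegni2017.splitLocalConstant 2`, unfolded); `v₂(u) = 4`. -/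
theorem splitLocalConstant_two : ((1 - ((2:ℚ) ^ 2)⁻¹) * (1 - (2:ℚ)⁻¹) ^ 2)⁻¹ = 16 / 3 := by norm_num

theorem splitLocalConstant_two_factor : (16 / 3 : ℚ) = 2 ^ 4 * 3⁻¹ := by norm_num

/-- The `p = 2` interpolation factor at `𝟙_K` as a rational multiple of `α₀^{-2c}`:
`Z°₂(𝟙_K) · α₀^{2c(e)} = (16/3) · χ_e(−1) · 2^{c(e)}` (replaces `zCircOne 2 α = (16/3)·2·α⁻²`, which is
the good-ordinary factor). -/
def zCircTwoRat (κ : DyadicClass) : ℚ := 16 / 3 * κ.gaussSqTwo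

theorem zCircTwoRat_values :
    zCircTwoRat .negOne = -64 / 3 ∧ zCircTwoRat .two = 128 / 3 ∧ zCircTwoRat .negTwo = -128 / 3 := by
  simp only [zCircTwoRat, DyadicClass.gaussSqTwo, DyadicClass.signAtNegOne, DyadicClass.condExp]
  norm_num

/-! ## §2 The MC⁻ valuation step on the line (PROVED) -/

open PowerSeries in
/-- If `f` vanishes to order `≥ n` then `[Tⁿ](f·h) = [Tⁿ]f · h(0)`. -/
theorem coeff_mul_eq_of_coeff_lt_eq_zero {R : Type*} [CommSemiring R] (f h : PowerSeries R) (n : ℕ)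
    (hf : ∀ i < n, coeff i f = 0) : coeff n (f * h) = coeff n f * coeff 0 h := by
  rw [coeff_mul]
  apply Finset.sum_eq_single (n, 0)
  · rintro ⟨i, j⟩ hx hne
    have hx' : i + j = n := by simpa using Finset.HasAntidiagonal.mem_antidiagonal.mp hx
    have hi : i < n := by
      by_contra hcon
      exact hne (by rw [show i = n by omega, show j = 0 by omega])
    rw [hf _ hi, zero_mul]
  · intro h0
    exact absurd (Finset.HasAntidiagonal.mem_antidiagonal.mpr (by simp)) h0

open PowerSeries in
/-- **MC⁻ on the line, valuation form.** If the (integral) line function `G` divides `f` in `ℤ_p⟦T⟧`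
(`char ⊆ (G)`, the `⊆`-half of a main conjecture restricted to the line) and `G` vanishes to order `≥ n`,
then `‖[Tⁿ] f‖ ≤ ‖[Tⁿ] G‖`, i.e. `v_p([Tⁿ]G) ≤ v_p([Tⁿ]f)`: the LOWER direction needs only divisibility,
never the reverse inclusion. -/
theorem norm_coeff_mul_le {p : ℕ} [Fact p.Prime] (G h : PowerSeries ℤ_[p]) (n : ℕ)
    (hG : ∀ i < n, coeff i G = 0) : ‖coeff n (G * h)‖ ≤ ‖coeff n G‖ := by
  rw [coeff_mul_eq_of_coeff_lt_eq_zero G h n hG]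
  calc ‖coeff n G * coeff 0 h‖ ≤ ‖coeff n G‖ * ‖coeff 0 h‖ := norm_mul_le _ _
    _ ≤ ‖coeff n G‖ * 1 := by gcongr; exact PadicInt.norm_le_one _
    _ = ‖coeff n G‖ := mul_one _

open PowerSeries in
theorem norm_coeff_le_of_dvd {p : ℕ} [Fact p.Prime] (G f : PowerSeries ℤ_[p]) (n : ℕ)
    (hG : ∀ i < n, coeff i G = 0) (hdvd : G ∣ f) : ‖coeff n f‖ ≤ ‖coeff n G‖ := by
  obtain ⟨h, rfl⟩ := hdvd
  exact norm_coeff_mul_le G h n hG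

/-! ## §3 The LOWER chain over the Heegner field `K` (integer-valuation shadow, PROVED)

Digits (all `v = ord₂` of nonzero quantities; the nonvanishing of `h₂(P_K)` is Bertrand-at-2, tree fact
`bertrand_pairingSq_self_ne_zero_two_of_j_eq_neg3375`, that of `[T¹]G` follows from Disegni's formula):
`vI = v[W(K):ℤP_K]`, `vc` Manin, `vSha = v #Ш(W/K)[2^∞]`, `vSan = v Ш_an(W/K)`, `vTam`, `vtors`,
`vH2 = v h₂(P_K,P_K)` (Disegni/Nekovář `2`-adic height), `vq = v(q)` (the common rational of the two ratio
clauses), `vG1 = v [T¹]G` (cyclotomic derivative of `L_{2,α}(σ_{W,K})`), `vlead = v` of the leading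
coefficient of `char X(W/K_cyc)`, `vZ = v Z°₂(𝟙_K) = 4 + c(e)`, `vlogγ = v log₂ γ = 2`,
`ν` = period-normalisation digit (YZZ's `Car` vs the Néron data of the stub's frame, incl. Manin `c`),
`ρ` = in-range comparison digit (Katz `G₂|_line` vs Disegni `L_{2,α}|_cyc`), `vD` = local descent digit at
`w ∣ 2`, `δ` = slack of ALG⁻. -/

/-- the digit record of road B⁻ over `K`. -/
structure RoadBMinusDigits where
  vI : ℤ
  vc : ℤ
  vSha : ℤ
  vSan : ℤ
  vTam : ℤ
  vtors : ℤ
  vH2 : ℤ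
  vq : ℤ
  vG1 : ℤ
  vlead : ℤ
  vZ : ℤ
  vlogγ : ℤ
  ν : ℤ
  ρ : ℤ
  vD : ℤ
  δ : ℤ

namespace RoadBMinusDigits

variable (d : RoadBMinusDigits)

/-- the road-B⁻ digit `κ = 1 + vZ − vlogγ + ν + ρ − vD − δ`. -/
def kappa : ℤ := 1 + d.vZ - d.vlogγ + d.ν + d.ρ - d.vD - d.δ

/-- **LOWER over `K` from Disegni + GZ + MC⁻ + ALG⁻.**
* `hDisegni`: Thm B ÷ (1.1.3) at `𝟙_K` in valuations — `[T¹]G = 2σ₀·Z°·h₂(P_K)/(q·log₂γ)`;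
* `hGZ`: Gross–Zagier/YZZ rationality and the definition of `Ш_an(W/K)` —
  `q = ĥ(P_K)/(Car·L′(W/K,1))`, `Ш_an = I²·tors²/(Tam·q·r_per)`, `v(r_per) = ν`;
* `hMC`: `char X(W/K_cyc) ⊆ (G|_cyc)` up to the in-range comparison digit `ρ` (§2);
* `hALG`: one-sided leading-term inequality, `Reg₂(W/K) = h₂(P_K)/I²`.
Conclusion: `vSan + κ ≤ vSha`. -/
theorem lower_of_disegni_mc_alg
    (hDisegni : d.vG1 = 1 + d.vZ + d.vH2 - d.vlogγ - d.vq)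
    (hGZ : d.vSan = 2 * d.vI + 2 * d.vtors - d.vTam - d.vq - d.ν)
    (hMC : d.vG1 + d.ρ ≤ d.vlead)
    (hALG : d.vlead ≤ d.vSha + (d.vH2 - 2 * d.vI) + d.vTam + d.vD - 2 * d.vtors + d.δ) :
    d.vSan + d.kappa ≤ d.vSha := by
  simp only [kappa]
  linarith

/-- LOWER proper: `κ ≥ 0` suffices. -/
theorem lower_of_kappa_nonneg
    (hDisegni : d.vG1 = 1 + d.vZ + d.vH2 - d.vlogγ - d.vq)
    (hGZ : d.vSan = 2 * d.vI + 2 * d.vtors - d.vTam - d.vq - d.ν)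
    (hMC : d.vG1 + d.ρ ≤ d.vlead)
    (hALG : d.vlead ≤ d.vSha + (d.vH2 - 2 * d.vI) + d.vTam + d.vD - 2 * d.vtors + d.δ)
    (hκ : 0 ≤ d.kappa) : d.vSan ≤ d.vSha := by
  have := d.lower_of_disegni_mc_alg hDisegni hGZ hMC hALG
  linarith

/-- **INDEX form = the stub's conclusion shape.** With the frame's Gross–Zagier identity in index currency
(`Ш_an(W/K)·Tam = (I/c)²` up to `2`-adic units, i.e. `vSan = 2vI − 2vc − vTam`) the LOWER bound reads
`2·vI − 2·vc ≤ vSha + vTam` — literally the inequality `stub_heegnerIndexLowerAtTwo` concludes (plus `κ`). -/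
theorem lower_index_form (hSan : d.vSan = 2 * d.vI - 2 * d.vc - d.vTam) (hlow : d.vSan + d.kappa ≤ d.vSha)
    (hκ : 0 ≤ d.kappa) : 2 * d.vI - 2 * d.vc ≤ d.vSha + d.vTam := by
  linarith

/-- the digit with Disegni's dyadic values plugged in: `vZ = 4 + c(e)`, `v log₂ γ = 2`
(`γ` a topological generator of `1 + 4ℤ₂`): `κ = 3 + c(e) + ν + ρ − vD − δ`. -/
theorem kappa_eq_of_dyadic (κ₀ : DyadicClass) (hZ : d.vZ = κ₀.zCircTwoVal) (hγ : d.vlogγ = 2) :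
    d.kappa = 3 + (κ₀.condExp : ℤ) + d.ν + d.ρ - d.vD - d.δ := by
  simp only [kappa, hZ, hγ, DyadicClass.zCircTwoVal]
  ring

end RoadBMinusDigits

/-! ## §4 Declared helper signatures (shapes; the real statements live over the tree's objects)

The four helpers the stub prover needs, stated abstractly so that this file elaborates on Mathlib alone.
The tree-typed forms are spelled out in the card (`STUB-IDEAS-…-2-g21.md`, PLAN 2): they quantify over
`PAdicHeightDataK W 2 K`, `CuspForm (Gamma0 N) 2`, `PowerSeries ℂ_[2]` exactly as
`Disegni2017.PAdicRatioClause` / `CycLineGrossZagierClauses` do at odd `p`, with `zCircOne` replaced by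
`zCircTwoRat κ · α₀^{-2c}` and `legendreLevel` by `χ_e` of level `2^{c(e)}`. -/

/-- **H1 (def, dictionary).** Thm B ÷ (1.1.3) at `𝟙_K`, `p = 2`, in ratio form over abstract carriers:
`h₂ = σ₀ · q · Z°₂(𝟙_K)⁻¹ · ½ · log₂ γ · [T¹]G`. (Shape of the tree-typed `padicRatioClauseAtTwo`.) -/
def PAdicRatioClauseAtTwoShape {C : Type*} [Field C] (h₂ q zCirc logγ G₁ : C) (σ₀ : ℤˣ) : Prop :=
  h₂ = ((σ₀ : ℤ) : C) * q * (zCirc⁻¹ * 2⁻¹ * logγ) * G₁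

/-- **H2 (PROVED above)** = `norm_coeff_le_of_dvd`. -/
example {p : ℕ} [Fact p.Prime] (G f : PowerSeries ℤ_[p]) (hG : PowerSeries.coeff 0 G = 0) (h : G ∣ f) :
    ‖PowerSeries.coeff 1 f‖ ≤ ‖PowerSeries.coeff 1 G‖ :=
  norm_coeff_le_of_dvd G f 1 (fun i hi ↦ by interval_cases i; exact hG) h

/-- **H3 (signature, S-sized): control on the line.** For a finitely generated torsion module `X` over
`Λ₂ = ℤ₂⟦S,T⟧` and the cyclotomic line ideal `𝔞`, the kernel of `X/𝔞X → X_cyc` is finite, so the leading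
coefficient of `char(X/𝔞X)` bounds that of `char(X_cyc)` from above in valuation — abstract shape:
a surjection with finite kernel does not lower the leading valuation. Declared helper, not proved here. -/
theorem controlKernelFiniteOnLine_shape (vlead_quot vlead_cyc vker : ℤ) (hker : 0 ≤ vker)
    (hexact : vlead_quot = vlead_cyc + vker) : vlead_cyc ≤ vlead_quot := by
  omega

/-- **H4 (signature, the ONE research helper) `AlgLowerK`.** One-sided rank-one leading-term inequality for
`X(W/K_cyc)` at nearly `2`-ordinary `2` (Greenberg local condition = the `χ_e`-twisted unramified line):
`v(lead char X(W/K_cyc)) ≤ v #Ш(W/K)[2^∞] + v Reg₂(W/K) + v Tam + v_D − 2 v #tors + δ` with an EXPLICIT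
`δ ≥ 0`. Print covers `p ≠ 2` (Schneider 1985, Perrin-Riou; Delbourgo 2002 additive odd `p`) and `p = 2`
GOOD ordinary over a field of everywhere good reduction (Li–Tian–Yan–Zhu 2025 §§4–6); the additive
`p = 2` case is open. Shape only: -/
def AlgLowerKShape (vlead vSha vReg vTam vD vtors δ : ℤ) : Prop :=
  0 ≤ δ ∧ vlead ≤ vSha + vReg + vTam + vD - 2 * vtors + δ

/-- **H-ρ (signature, M-sized) `InRangeComparison`.** On the cyclotomic line, Disegni's `L_{2,α}(σ_{W,K})`
and the product of the two Katz–de Shalit measures of `ψ_W`, `ψ_W·χ_{D_K}` (ramified range, de Shalit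
II.4.14) interpolate the same critical values at every finite-order character of conductor `≥ 2^{c(e)}`
up to ONE explicit constant; Weierstrass-preparation uniqueness then identifies them up to that constant,
whose valuation is `ρ`. Shape: two line functions agreeing at infinitely many points of the open disc
differ by the constant. Declared helper, not proved here (the tree's
`MemIwasawaRat.eq_of_forall_hasSum`-type uniqueness is the engine). -/
def InRangeComparisonShape {C : Type*} [Field C] (G₁disegni G₁katz u : C) : Prop :=
  u ≠ 0 ∧ G₁disegni = u * G₁katz

end Summit.BirchSwinnertonDyer.BirchSwinnertonDyer.Cruxes.SplitBadTwoLowerHalfOfFacts.StubIdeasK2G21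

/-! ## §5 The tree-typed `p = 2` dictionary (Disegni 2017 Thm A on the line ∧ Thm B ÷ (1.1.3) at `𝟙_K`) -/

noncomputable section
open scoped MatrixGroups ModularForm NumberField
open CongruenceSubgroup NumberField IsDedekindDomain WeierstrassCurve
open Literature.NumberTheory.GaloisRepresentations
open Literature.NumberTheory.EllipticCurves Literature.NumberTheory.EllipticCurves.ModularForms
open Literature.NumberTheory.EllipticCurves.Disegni2017

namespace Summit.BirchSwinnertonDyer.BirchSwinnertonDyer.Cruxes.SplitBadTwoLowerHalfOfFacts.StubIdeasK2G21.Typed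

instance : Fact (Nat.Prime 2) := ⟨Nat.prime_two⟩

variable (ι : PadicAlgCl 2 ≃+* ℂ) (K : Type) [Field K] [NumberField K] [IsGalois ℚ K] {N : ℕ}

/-- Disegni's complex interpolation value on the cyclotomic line at `p = 2` for the nearly `2`-ordinary
`σ_{W,2}` with RAMIFIED unit character `α₂ = α₀·χ` (`χ = χ_e` of conductor `2^c`, pushed to level
`2^{m+1} ≥ 2^c`): `u · g(θ⁻¹χ)² · Car · L₁` (both places `w ∣ 2`: `Z_w(θ_w) = α₀(2)^{-(m+1)} g(θ⁻¹χ)`). -/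
def cycLineComplexPartTwo {c m : ℕ} (hcm : c ≤ m + 1) (χ : DirichletCharacter ℂ (2 ^ c))
    (θ : DirichletCharacter ℂ (2 ^ (m + 1))) (Car : ℝ) (L₁ : ℂ) : ℂ :=
  (splitLocalConstant 2 : ℂ) *
    gaussSum (θ⁻¹ * DirichletCharacter.changeLevel (pow_dvd_pow 2 hcm) χ)
      (ZMod.stdAddChar (N := 2 ^ (m + 1))) ^ 2 * (Car : ℂ) * L₁

def cycLineValueTwo (α₀ : ℚ_[2]) {c m : ℕ} (hcm : c ≤ m + 1) (χ : DirichletCharacter ℂ (2 ^ c))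
    (θ : DirichletCharacter ℂ (2 ^ (m + 1))) (Car : ℝ) (L₁ : ℂ) : ℂ_[2] :=
  algebraMap ℚ_[2] ℂ_[2] ((α₀⁻¹) ^ (2 * (m + 1))) *
    ((ι.symm (cycLineComplexPartTwo hcm χ θ Car L₁) : PadicAlgCl 2) : ℂ_[2])

/-- **Theorem A on the cyclotomic line at `p = 2`, ramified unit character** (shape of the tree's
`CycLineInterpolation` with `legendreLevel p` ↦ `χ` of conductor `2^c`, levels `≥ 2^c`). PREDICATE. -/
def CycLineInterpolationTwo {c : ℕ} (χ : DirichletCharacter ℂ (2 ^ c)) (fE : CuspForm (Gamma0 N) 2)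
    (α₀ : ℚ_[2]) (Car : ℝ) (G : PowerSeries ℂ_[2]) : Prop :=
  IsLineFunction G ∧
    ∀ (m : ℕ) (hcm : c ≤ m + 1) (θ : DirichletCharacter ℂ (2 ^ (m + 1))), θ.Even →
      (θ.IsPrimitive ∨ m + 1 = c) →
      ∀ Λ : ℂ → ℂ, Differentiable ℂ Λ →
        (∀ s : ℂ, 2 < s.re → Λ s = rankinSelbergEulerProductHecke fE (baseChangeDirichlet K θ) s) →
        HasLineValueAt G (cycLinePoint ι θ) (cycLineValueTwo ι α₀ hcm χ θ Car (Λ 1))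

/-- `Z°₂(𝟙_K) = u · g(χ)² · α₀^{-2c}` with `g(χ)² = χ(−1)·2^c` supplied as the integer `gsq`
(`−4, 8, −8` for `χ_{−4}, χ_8, χ_{−8}`); replaces `zCircOne 2 α`. -/
def zCircTwo (α₀ : ℚ_[2]) (c : ℕ) (gsq : ℤ) : ℚ_[2] :=
  (splitLocalConstant 2 : ℚ_[2]) * (gsq : ℚ_[2]) * (α₀ ^ (2 * c))⁻¹

variable (W : WeierstrassCurve ℚ)

/-- **Theorem B ÷ (1.1.3) at `𝟙_K`, `p = 2`** (shape of `PAdicRatioClause` with `zCircOne` ↦ `zCircTwo`):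
`h₂(P₁,P₂) = σ₀ · q · Z°₂(𝟙_K)⁻¹ · ½ · log₂ γ · [T¹]G`, `γ = cyclotomicGenerator 2 = 5`. PREDICATE over an
abstract `K`-height datum at `2` (the canonical one is Nekovář's for the nearly-ordinary line). -/
def PAdicRatioClauseTwo (α₀ : ℚ_[2]) (c : ℕ) (gsq : ℤ) (G : PowerSeries ℂ_[2])
    (DhK : PAdicHeightDataK W 2 K) (P₁ P₂ : (W.baseChange K).toAffine.Point) (q : ℚ) (σ₀ : ℤˣ) : Prop :=
  algebraMap ℚ_[2] ℂ_[2] (DhK.pairing P₁ P₂) =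
    ((σ₀ : ℤ) : ℂ_[2]) * (q : ℂ_[2]) *
      algebraMap ℚ_[2] ℂ_[2] ((zCircTwo α₀ c gsq)⁻¹ * 2⁻¹ * padicLog 2 (cyclotomicGenerator 2)) *
      PowerSeries.coeff 1 G

/-- **Disegni 2017 Thm A (line) ∧ Thm B ÷ (1.1.3) at `𝟙_K` for `p = 2`, ramified unit character** — the
`p = 2` twin of `CycLineGrossZagierClauses` (same `ArchRatioClause`, by name). PREDICATE; under the audited
hypotheses (K imaginary quadratic, every prime of `N_W` split in `K`, `σ_{W,2}` nearly ordinary with unit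
character `α₀·χ_e`) the printed theorems give it for the canonical height datum. -/
def CycLineGrossZagierClausesTwo {c : ℕ} (χ : DirichletCharacter ℂ (2 ^ c)) (gsq : ℤ)
    (fE : CuspForm (Gamma0 N) 2) (α₀ : ℚ_[2]) (DhK : PAdicHeightDataK W 2 K) : Prop :=
  ∃ Car : ℝ, 0 < Car ∧ ∃ G : PowerSeries ℂ_[2], CycLineInterpolationTwo ι K (χ := χ) fE α₀ Car G ∧
    ∃ (P₁ P₂ : (W.baseChange K).toAffine.Point) (q : ℚ) (σ₀ : ℤˣ), q ≠ 0 ∧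
      ArchRatioClause W K fE Car P₁ P₂ q ∧ PAdicRatioClauseTwo K W α₀ c gsq G DhK P₁ P₂ q σ₀

/-- sanity: at `p = 2` the tree's odd-`p` Legendre character is trivial (it types the GOOD ordinary
unit character, not the twin's). -/
example : quadraticChar (ZMod 2) 1 = 1 := by decide

end Summit.BirchSwinnertonDyer.BirchSwinnertonDyer.Cruxes.SplitBadTwoLowerHalfOfFacts.StubIdeasK2G21.Typed

end
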